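import Mathlib.Analysis.SpecialFunctions.Trigonometric.Chebyshev.Basic
import Mathlib.Analysis.SpecialFunctions.Trigonometric.Inverse
import Mathlib.Analysis.SpecialFunctions.Log.Basic
import Mathlib.Analysis.Calculus.Deriv.Polynomial

/-!
# An explicit sign polynomial, part I: the integrated Chebyshev needle (algebra and pointwise bounds)

HONEST FRAMING: instance-level adjudication of specific advantage claims; no claim about
BQP vs BPP or the summit.

Context (cell pub-qadeq; see `SignPolynomial.lean` in this directory for the statement this
serves).  The in-tree "Gharibian–Le Gall road" (`Literature/Computability/QuantumComplexity/
SparseQSVTEstimation.lean`, `RectanglePolynomial.lean`, `GuidedLocalHamiltonianDecision.lean`)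
takes the Low–Chuang / GSLW19-Lemma-25 sign polynomial as the hypothesis class `SignApprox η ξ p`
and cites its degree bound.  This file and `SignPolynomial.lean` are OUR elementary construction
(new work, hence under `Summits/`) of a member of that class with an explicit degree bound
`≤ 5·ln(16/(ηξ))/η + 5` — weaker than the cited `O(log(1/ξ)/η)` by the `log(1/η)/η` term, but
proved, and enough to free GL22 §4 (Theorem 1 / Proposition 1, constant parameters) of cited
analytic input.

This part: with `c = 2/(4−η²)` and `u(t) = 1 + c(η² − t²)` (`u(±η) = 1`, `u(±2) = −1`), the needle
`b(t) = T_m(u(t))²` as a polynomial `q` in `y = t²` (`needleSq`); the pointwise bounds `0 ≤ b`,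
`b ≤ 1` for `η ≤ |t| ≤ 2` (`|T_m| ≤ 1` on `[−1,1]` via `T_m(cos θ) = cos mθ`), and
`b ≥ ((1+4η/5)^m/2)²` for `|t| ≤ η/2` (via `T_m(cosh θ) = cosh mθ ≥ e^{mθ}/2`,
`e^θ = u + √(u²−1) ≥ 1 + 4η/5`); the odd antiderivative `P = X·q̃(X²)`, `q̃ = ∑ q_k X^k/(2k+1)`,
with `P' = q(X²) = b` proved coefficientwise (`derivative_oddAntideriv`); the normalised
`signPoly = P/P(2)` and its degree bound `≤ 4m+1`.  No named facts, standard axioms only.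

References (context only): Low–Chuang arXiv:1707.05391; Gilyén–Su–Low–Wiebe STOC 2019
(arXiv:1806.01838, Lemma 24/25); Gharibian–Le Gall STOC 2022 (arXiv:2111.09079) §4.
-/

noncomputable section

namespace Summit.QuantumAdvantage.Dequantization.SignPolynomial

open Polynomial Finset

/-! ### Chebyshev values: bounded by `1` on `[−1,1]`, exponentially large beyond `1` -/

/-- `|T_m(y)| ≤ 1` for `y ∈ [−1,1]` (`y = cos θ`, `T_m(cos θ) = cos(mθ)`). -/
theorem abs_chebyshev_le_one (m : ℕ) {y : ℝ} (h1 : -1 ≤ y) (h2 : y ≤ 1) :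
    |(Chebyshev.T ℝ (m : ℤ)).eval y| ≤ 1 := by
  rw [← Real.cos_arccos h1 h2, Polynomial.Chebyshev.T_real_cos]
  exact Real.abs_cos_le_one _

/-- `T_m(y) ≥ (1 + √(y²−1))^m / 2` for `y ≥ 1` (`y = cosh θ` with `e^θ = y + √(y²−1)`,
`T_m(cosh θ) = cosh(mθ) ≥ e^{mθ}/2`). -/
theorem chebyshev_ge_of_one_le (m : ℕ) {y : ℝ} (hy : 1 ≤ y) :
    (1 + Real.sqrt (y ^ 2 - 1)) ^ m / 2 ≤ (Chebyshev.T ℝ (m : ℤ)).eval y := by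
  set s := Real.sqrt (y ^ 2 - 1) with hs
  have hs0 : 0 ≤ s := Real.sqrt_nonneg _
  have hs2 : s ^ 2 = y ^ 2 - 1 := Real.sq_sqrt (by nlinarith)
  set ρ := y + s with hρ
  have hρ0 : 0 < ρ := by linarith
  have hmul : ρ * (y - s) = 1 := by rw [hρ]; nlinarith [hs2]
  have hinv : ρ⁻¹ = y - s := inv_eq_of_mul_eq_one_right hmul
  set θ := Real.log ρ with hθ
  have hexp : Real.exp θ = ρ := Real.exp_log hρ0
  have hcosh : Real.cosh θ = y := by
    rw [Real.cosh_eq, Real.exp_neg, hexp, hinv]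
    ring
  have hT : (Chebyshev.T ℝ (m : ℤ)).eval y = Real.cosh (m * θ) := by
    rw [← hcosh, Polynomial.Chebyshev.T_real_cosh]
    norm_cast
  rw [hT, Real.cosh_eq]
  have h1 : Real.exp (m * θ) = ρ ^ m := by rw [Real.exp_nat_mul, hexp]
  have h2 : 0 < Real.exp (-(m * θ)) := Real.exp_pos _
  have h3 : (1 + s) ^ m ≤ ρ ^ m := pow_le_pow_left₀ (by linarith) (by linarith) m
  rw [h1]
  linarith

/-! ### The needle `b(t) = T_m(u(t))²`, `u(t) = 1 + c(η² − t²)`, as a polynomial in `y = t²` -/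

/-- `c = 2/(4 − η²)`. -/
def needleC (η : ℝ) : ℝ := 2 / (4 - η ^ 2)

/-- `u` as a polynomial in `y = t²`: `u = (1 + cη²) − c·y`. -/
def needleArg (η : ℝ) : ℝ[X] := C (1 + needleC η * η ^ 2) - C (needleC η) * X

/-- `q(y) = T_m(u(y))²`, so that `b(t) = q(t²)`. -/
def needleSq (η : ℝ) (m : ℕ) : ℝ[X] := ((Chebyshev.T ℝ (m : ℤ)).comp (needleArg η)) ^ 2

/-- `u(y) = 1 + c(η² − y)`. -/
theorem eval_needleArg (η y : ℝ) : (needleArg η).eval y = 1 + needleC η * (η ^ 2 - y) := by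
  simp only [needleArg, eval_sub, eval_mul, eval_C, eval_X]
  ring

/-- `q(y) = T_m(u(y))²`. -/
theorem eval_needleSq (η : ℝ) (m : ℕ) (y : ℝ) :
    (needleSq η m).eval y = ((Chebyshev.T ℝ (m : ℤ)).eval (1 + needleC η * (η ^ 2 - y))) ^ 2 := by
  simp only [needleSq, eval_pow, eval_comp, eval_needleArg]

/-- `1/2 ≤ c ≤ 2/3` for `0 < η ≤ 1`. -/
theorem needleC_bounds {η : ℝ} (hη : 0 < η) (hη1 : η ≤ 1) :
    1 / 2 ≤ needleC η ∧ needleC η ≤ 2 / 3 := by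
  have h4 : 3 ≤ 4 - η ^ 2 := by nlinarith
  have h4' : 4 - η ^ 2 ≤ 4 := by nlinarith
  have hpos : 0 < 4 - η ^ 2 := by linarith
  unfold needleC
  constructor
  · rw [div_le_div_iff₀ (by norm_num) hpos]; linarith
  · rw [div_le_div_iff₀ hpos (by norm_num)]; linarith

/-- `c(η² − 4) = −2`: `u(±2) = −1`. -/
theorem needleC_mul {η : ℝ} (hη1 : η ≤ 1) (hη0 : 0 ≤ η) : needleC η * (η ^ 2 - 4) = -2 := by
  have hpos : 4 - η ^ 2 ≠ 0 := by nlinarith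
  unfold needleC
  field_simp
  ring

/-- On `η ≤ |t| ≤ 2` (i.e. `η² ≤ y ≤ 4`): `u ∈ [−1,1]`, hence `b = T_m(u)² ≤ 1`; and `b ≥ 0`
everywhere. -/
theorem eval_needleSq_le_one {η : ℝ} (hη : 0 < η) (hη1 : η ≤ 1) (m : ℕ) {y : ℝ}
    (hy1 : η ^ 2 ≤ y) (hy2 : y ≤ 4) : (needleSq η m).eval y ≤ 1 := by
  obtain ⟨hc1, hc2⟩ := needleC_bounds hη hη1
  have hm2 := needleC_mul hη1 hη.le
  rw [eval_needleSq]
  set u := 1 + needleC η * (η ^ 2 - y)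
  have hu1 : -1 ≤ u := by
    have : needleC η * (η ^ 2 - 4) ≤ needleC η * (η ^ 2 - y) :=
      mul_le_mul_of_nonneg_left (by linarith) (by linarith)
    linarith
  have hu2 : u ≤ 1 := by
    have : needleC η * (η ^ 2 - y) ≤ 0 := mul_nonpos_of_nonneg_of_nonpos (by linarith) (by linarith)
    linarith
  have h := abs_chebyshev_le_one m hu1 hu2
  rw [abs_le] at h
  nlinarith [h.1, h.2]

/-- `q ≥ 0` (a square). -/
theorem eval_needleSq_nonneg (η : ℝ) (m : ℕ) (y : ℝ) : 0 ≤ (needleSq η m).eval y := by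
  rw [eval_needleSq]; exact sq_nonneg _

/-- On `|t| ≤ η/2` (i.e. `y ≤ η²/4`): `u ≥ 1 + 3η²/8`, `√(u²−1) ≥ 4η/5`, so
`b = T_m(u)² ≥ ((1+4η/5)^m/2)²`. -/
theorem eval_needleSq_ge {η : ℝ} (hη : 0 < η) (hη1 : η ≤ 1) (m : ℕ) {y : ℝ}
    (hy : y ≤ η ^ 2 / 4) : ((1 + 4 * η / 5) ^ m / 2) ^ 2 ≤ (needleSq η m).eval y := by
  obtain ⟨hc1, hc2⟩ := needleC_bounds hη hη1
  rw [eval_needleSq]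
  set u := 1 + needleC η * (η ^ 2 - y) with hu
  have hu1 : 1 + 3 * η ^ 2 / 8 ≤ u := by
    have : 1 / 2 * (3 * η ^ 2 / 4) ≤ needleC η * (η ^ 2 - y) :=
      mul_le_mul hc1 (by linarith) (by nlinarith) (by linarith)
    linarith
  have hu1' : 1 ≤ u := by nlinarith
  have hsq : (4 * η / 5) ^ 2 ≤ u ^ 2 - 1 := by nlinarith
  have hsqrt : 4 * η / 5 ≤ Real.sqrt (u ^ 2 - 1) := Real.le_sqrt_of_sq_le hsq
  have hT := chebyshev_ge_of_one_le m hu1'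
  have hbase : (1 + 4 * η / 5) ^ m / 2 ≤ (1 + Real.sqrt (u ^ 2 - 1)) ^ m / 2 := by
    have h0' : (0 : ℝ) ≤ 1 + 4 * η / 5 := by positivity
    have := pow_le_pow_left₀ h0' (by linarith : 1 + 4 * η / 5 ≤ 1 + Real.sqrt (u ^ 2 - 1)) m
    linarith
  have h0 : 0 ≤ (1 + 4 * η / 5) ^ m / 2 := by positivity
  exact pow_le_pow_left₀ h0 (hbase.trans hT) 2

/-! ### The odd antiderivative `P = X · q̃(X²)` of `b = q(X²)` -/

/-- `q̃ = ∑_k q_k/(2k+1) · X^k`. -/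
def divOdd (q : ℝ[X]) : ℝ[X] :=
  ∑ k ∈ range (q.natDegree + 1), C (q.coeff k / (2 * k + 1)) * X ^ k

/-- `coeff_k q̃ = q_k/(2k+1)`. -/
theorem coeff_divOdd (q : ℝ[X]) (k : ℕ) : (divOdd q).coeff k = q.coeff k / (2 * k + 1) := by
  rw [divOdd, finsetSum_coeff]
  simp only [coeff_C_mul_X_pow]
  rw [Finset.sum_eq_single k]
  · simp
  · intro j _ hj
    simp [Ne.symm hj]
  · intro hk
    have h0 : q.coeff k = 0 := by
      refine coeff_eq_zero_of_natDegree_lt ?_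
      have := Finset.mem_range.not.1 hk
      omega
    simp [h0]

/-- The coefficient identity behind `P' = b`: `q̃ + 2X·q̃' = q`. -/
theorem divOdd_add_deriv (q : ℝ[X]) : divOdd q + C 2 * X * derivative (divOdd q) = q := by
  ext k
  rw [coeff_add, show C (2 : ℝ) * X * derivative (divOdd q) = C 2 * (X * derivative (divOdd q)) by
    ring, coeff_C_mul]
  rcases k with _ | k
  · rw [coeff_divOdd, mul_coeff_zero, coeff_X_zero, zero_mul, mul_zero, add_zero]
    simp
  · rw [coeff_X_mul, coeff_derivative, coeff_divOdd]
    push_cast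
    have h : (2 * ((k : ℝ) + 1) + 1) ≠ 0 := by positivity
    field_simp
    ring

/-- `deg q̃ ≤ deg q`. -/
theorem natDegree_divOdd_le (q : ℝ[X]) : (divOdd q).natDegree ≤ q.natDegree := by
  unfold divOdd
  refine natDegree_sum_le_of_forall_le _ _ fun k hk => ?_
  refine (natDegree_C_mul_X_pow_le _ _).trans ?_
  have := Finset.mem_range.1 hk
  omega

/-- `P = X · q̃(X²)`. -/
def oddAntideriv (q : ℝ[X]) : ℝ[X] := X * (divOdd q).comp (X ^ 2)

/-- `P' = q(X²)` (`= b`). -/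
theorem derivative_oddAntideriv (q : ℝ[X]) :
    derivative (oddAntideriv q) = q.comp (X ^ 2) := by
  rw [oddAntideriv, derivative_mul, derivative_X, one_mul, derivative_comp, derivative_X_pow]
  conv_rhs => rw [← divOdd_add_deriv q]
  rw [add_comp, mul_comp, mul_comp, C_comp, X_comp]
  simp only [Nat.cast_ofNat, Nat.add_one_sub_one, pow_one]
  ring

/-- `P(x) = x·q̃(x²)`. -/
theorem eval_oddAntideriv (q : ℝ[X]) (x : ℝ) :
    (oddAntideriv q).eval x = x * (divOdd q).eval (x ^ 2) := by
  simp [oddAntideriv, eval_comp]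

/-- `P` is odd: `P(−x) = −P(x)`. -/
theorem eval_oddAntideriv_neg (q : ℝ[X]) (x : ℝ) :
    (oddAntideriv q).eval (-x) = -(oddAntideriv q).eval x := by
  rw [eval_oddAntideriv, eval_oddAntideriv, neg_sq]
  ring

/-- `P(0) = 0`. -/
theorem eval_oddAntideriv_zero (q : ℝ[X]) : (oddAntideriv q).eval 0 = 0 := by
  simp [eval_oddAntideriv]

/-- `deg P ≤ 2 deg q + 1`. -/
theorem natDegree_oddAntideriv_le (q : ℝ[X]) :
    (oddAntideriv q).natDegree ≤ 2 * q.natDegree + 1 := by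
  unfold oddAntideriv
  refine natDegree_mul_le.trans ?_
  have h1 : (X : ℝ[X]).natDegree ≤ 1 := natDegree_X_le
  have h2 : ((divOdd q).comp (X ^ 2)).natDegree ≤ 2 * q.natDegree := by
    refine natDegree_comp_le.trans ?_
    rw [natDegree_X_pow, mul_comm]
    exact Nat.mul_le_mul_left 2 (natDegree_divOdd_le q)
  omega

/-- `deriv (x ↦ P(x)) = (x ↦ q(x²))`. -/
theorem deriv_oddAntideriv (q : ℝ[X]) (x : ℝ) :
    deriv (fun x => (oddAntideriv q).eval x) x = q.eval (x ^ 2) := by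
  rw [Polynomial.deriv, derivative_oddAntideriv, eval_comp, eval_pow, eval_X]

/-! ### The sign polynomial `p = P/P(2)` -/

/-- The unnormalised `P = ∫₀ b` for the needle of parameters `(η, m)`. -/
def signPolyRaw (η : ℝ) (m : ℕ) : ℝ[X] := oddAntideriv (needleSq η m)

/-- The sign polynomial `p = P/P(2)`. -/
def signPoly (η : ℝ) (m : ℕ) : ℝ[X] := C (1 / (signPolyRaw η m).eval 2) * signPolyRaw η m

/-- `deg q ≤ 2m` (`T_m` has degree `m`, `u` is linear in `y`). -/
theorem natDegree_needleSq_le (η : ℝ) (m : ℕ) : (needleSq η m).natDegree ≤ 2 * m := by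
  unfold needleSq
  refine natDegree_pow_le.trans ?_
  refine Nat.mul_le_mul_left 2 ?_
  refine natDegree_comp_le.trans ?_
  have hT : (Chebyshev.T ℝ (m : ℤ)).natDegree = m := by
    rw [Polynomial.Chebyshev.natDegree_T]; simp
  have harg : (needleArg η).natDegree ≤ 1 := by
    unfold needleArg
    refine (natDegree_sub_le _ _).trans (max_le (by rw [natDegree_C]; exact zero_le_one) ?_)
    exact (natDegree_C_mul_le _ _).trans natDegree_X_le
  rw [hT]
  calc m * (needleArg η).natDegree ≤ m * 1 := Nat.mul_le_mul_left m harg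
    _ = m := mul_one m

/-- **Degree bound**: `deg p ≤ 4m + 1`. -/
theorem natDegree_signPoly_le (η : ℝ) (m : ℕ) : (signPoly η m).natDegree ≤ 4 * m + 1 := by
  unfold signPoly signPolyRaw
  refine (natDegree_C_mul_le _ _).trans ((natDegree_oddAntideriv_le _).trans ?_)
  have := natDegree_needleSq_le η m
  omega

end Summit.QuantumAdvantage.Dequantization.SignPolynomial

end
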